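import Summits.CriticalPhenomena.PercolationContinuityZ3.Theorems.PercNearOneGluingNoHeavyLowerTailSahiThreeCopyCellC6All
import Summits.CriticalPhenomena.PercolationContinuityZ3.Theorems.PercNearOneGluingNoHeavyLowerTailSahiThreeCopyHitPairsSix

/-!
# `NoHeavyLowerTail` (crux stmt-CriticalPhenomena-4575), Sahi programme: assembling `LawGood k π 1_X` over ALL front profiles

Support file (Sahi cell, seat `prim-sahi-p1`, generation 65; `--supports stmt-CriticalPhenomena-4575`).  Pure bookkeeping for the slot theorems
`∀ π, LawGood k π 1_X` (the cell certificates give the INTERIOR profiles `π ∈ {1,2}^k` class by class; this file supplies the rest):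

* `profB k m` — the interior profile with mask `m` (`prof6`, `prof8` are the cases `k = 6, 8`); `exists_profB_eq`;
* ★ `lawGood_succ_of_boundary` — a profile with an entry `0` or `≥ 3` at coordinate `i`: relabel `i` to the front, freeze it (`lawGood_cons_zero/three`),
  and the claim reduces to law-level goodness of the two SECTIONS of the slot (as slots on `k` coordinates) at every profile;
* `lawGood_all_of_interior_of_boundary` — the interior/boundary split; `lawGood_all_map_relab` — a relabelled slot inherits "all profiles";
* `lawGood_setInd_empty` — the empty slot; `lawGood_seven/eight_all_of_interior_of_sections`.  (At `k = 6` the boundary is free for every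
  up-set — `frontGood_six_of_boundary`, a computational fact — used directly in the family files.)

The recursion this serves (memo §6): `C₈` at a boundary profile has sections `x ∧ C₆` / `C₆ + dummy` (7 coordinates), whose boundary sections are
`x ∧ y ∧ C₄`, `x ∧ C₄ + dummy`, `C₄ + 2 dummies`, `C₆`, `∅` (6 coordinates), whose boundary sections are up-sets on `5` coordinates (free). [this work]
-/

namespace Summit.CriticalPhenomena.PercolationContinuityZ3.Theorems.SahiThreeCopy

open Finset Function Literature.Combinatorics.Sahi2008
open scoped BigOperators

variable {k : ℕ}

/-! ### §1 Interior profiles -/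

/-- The interior front profile with mask `m`: entry `2` where the bit of `m` is set, else `1`. [this work] -/
def profB (k m : ℕ) : Fin k → ℕ := fun i => if m.testBit i.val then 2 else 1

/-- `prof6 = profB 6`. [this work] -/
theorem prof6_eq_profB (m : ℕ) : prof6 m = profB 6 m := rfl

/-- `prof8 = profB 8`. [this work] -/
theorem prof8_eq_profB (m : ℕ) : prof8 m = profB 8 m := rfl

/-- Every profile with entries in `{1,2}` is an interior profile `profB k m`, `m < 2^k`. [this work] -/
theorem exists_profB_eq : ∀ {k : ℕ} (π : Fin k → ℕ), (∀ i, π i = 1 ∨ π i = 2) → ∃ m, m < 2 ^ k ∧ π = profB k m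
  | 0, π, _ => ⟨0, by norm_num, funext fun i => Fin.elim0 i⟩
  | k + 1, π, h => by
    obtain ⟨m', hm', htail⟩ := exists_profB_eq (Fin.tail π) fun i => h i.succ
    refine ⟨2 * m' + (if π 0 = 2 then 1 else 0), ?_, funext fun i => ?_⟩
    · split_ifs <;> omega
    · refine Fin.cases ?_ (fun j => ?_) i
      · simp only [profB, Fin.val_zero, Nat.testBit_zero]
        rcases h 0 with h0 | h0 <;> simp [h0]
      · have hj : π j.succ = profB k m' j := by rw [← htail]; rfl
        rw [hj]
        simp only [profB, Fin.val_succ, Nat.testBit_succ]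
        have : (2 * m' + if π 0 = 2 then 1 else 0) / 2 = m' := by split_ifs <;> omega
        rw [this]

/-- ★ Interior/boundary split: if the slot is law-good at every interior profile and at every profile with an entry `0` or `≥ 3`, it is
law-good at every profile. [this work] -/
theorem lawGood_all_of_interior_of_boundary {f : Pt k → ℝ} (hint : ∀ m, m < 2 ^ k → LawGood k (profB k m) f)
    (hbd : ∀ (π : Fin k → ℕ) (i : Fin k), (π i = 0 ∨ 3 ≤ π i) → LawGood k π f) (π : Fin k → ℕ) : LawGood k π f := by
  by_cases hb : ∃ i, π i = 0 ∨ 3 ≤ π i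
  · obtain ⟨i, hi⟩ := hb; exact hbd π i hi
  · have h12 : ∀ i, π i = 1 ∨ π i = 2 := fun i => by by_contra hc; exact hb ⟨i, by omega⟩
    obtain ⟨m, hm, rfl⟩ := exists_profB_eq π h12
    exact hint m hm

/-! ### §2 Boundary profiles: relabel, freeze, take sections -/

/-- ★ **Boundary reduction at law level.**  If `π i = 0` or `π i ≥ 3`, then `LawGood (k+1) π 1_A` follows from law-level goodness, at every
profile, of the two sections of `A` along coordinate `i` (moved to the front by the transposition `(0 i)`). [this work] -/
theorem lawGood_succ_of_boundary (π : Fin (k + 1) → ℕ) (i : Fin (k + 1)) (hi : π i = 0 ∨ 3 ≤ π i) (A : Finset (Pt (k + 1)))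
    (h : ∀ (ε : Bool) (π' : Fin k → ℕ), LawGood k π' (setInd (secSet (A.map (relab (Equiv.swap 0 i)).symm.toEmbedding) ε))) :
    LawGood (k + 1) π (setInd A) := by
  by_cases h4 : 4 ≤ π i
  · exact lawGood_of_four_le π h4 _
  set σ : Equiv.Perm (Fin (k + 1)) := Equiv.swap 0 i with hσ
  have hπ : π = (π ∘ σ) ∘ σ := by
    funext j; simp only [Function.comp_apply, hσ, Equiv.swap_apply_self]
  rw [hπ]
  apply lawGood_relab σ
  rw [setInd_comp_relab]
  have h0 : (π ∘ σ) 0 = π i := by simp only [Function.comp_apply, hσ, Equiv.swap_apply_left]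
  rcases hi with h' | h'
  · refine lawGood_cons_zero (by rw [h0, h']) ?_
    rw [setInd_cons_eq]; exact h false _
  · refine lawGood_cons_three (by rw [h0]; omega) ?_
    rw [setInd_cons_eq]; exact h true _

/-- A relabelled slot inherits law-level goodness at all profiles. [this work] -/
theorem lawGood_all_map_relab (σ : Equiv.Perm (Fin k)) {X : Finset (Pt k)} (h : ∀ π, LawGood k π (setInd X)) (π : Fin k → ℕ) :
    LawGood k π (setInd (X.map (relab σ).toEmbedding)) := by
  have hπ : π = (π ∘ σ.symm) ∘ σ := by
    funext j; simp only [Function.comp_apply, Equiv.symm_apply_apply]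
  rw [hπ]
  apply lawGood_relab σ
  rw [setInd_map_comp_relab]
  exact h _

/-- `frontFn` of the zero slot is zero (local copy of `frontFn_zero`, `…JuntaFive`). [this work] -/
private theorem frontFn_zero_aux {d : ℕ} : ∀ k : ℕ, frontFn (d := d) k (fun _ => (0 : ℝ)) = 0
  | 0 => rfl
  | k + 1 => by
    funext w
    show frontFn k (fun _ => (0 : ℝ)) (Fin.tail w) = 0
    rw [frontFn_zero_aux k]; rfl

/-- The empty slot is law-good at every profile (all terms vanish). [this work] -/
theorem lawGood_setInd_empty (π : Fin k → ℕ) : LawGood k π (setInd (∅ : Finset (Pt k))) := by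
  have : setInd (∅ : Finset (Pt k)) = fun _ => (0 : ℝ) := by
    funext e; simp only [setInd, Finset.notMem_empty, if_false]
  rw [this]
  intro d q hq G H hG hG1 hH hH1 hGm hHm
  refine Finset.sum_nonneg fun b _ => ?_
  rw [frontFn_zero_aux, tc_zero_left, mul_zero]

/-! ### §3 Seven and eight coordinates: interior plus sections -/

/-- ★ At `k = 7`: interior profiles plus, for every coordinate `i` and sign `ε`, law-level goodness of the section slot at all profiles. [this work] -/
theorem lawGood_seven_all_of_interior_of_sections {A : Finset (Pt 7)} (hint : ∀ m, m < 128 → LawGood 7 (profB 7 m) (setInd A))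
    (hsec : ∀ (i : Fin 7) (ε : Bool) (π' : Fin 6 → ℕ), LawGood 6 π' (setInd (secSet (A.map (relab (Equiv.swap 0 i)).symm.toEmbedding) ε)))
    (π : Fin 7 → ℕ) : LawGood 7 π (setInd A) :=
  lawGood_all_of_interior_of_boundary hint (fun π i hi => lawGood_succ_of_boundary π i hi A fun ε π' => hsec i ε π') π

/-- ★ At `k = 8`: the same one level up. [this work] -/
theorem lawGood_eight_all_of_interior_of_sections {A : Finset (Pt 8)} (hint : ∀ m, m < 256 → LawGood 8 (profB 8 m) (setInd A))
    (hsec : ∀ (i : Fin 8) (ε : Bool) (π' : Fin 7 → ℕ), LawGood 7 π' (setInd (secSet (A.map (relab (Equiv.swap 0 i)).symm.toEmbedding) ε)))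
    (π : Fin 8 → ℕ) : LawGood 8 π (setInd A) :=
  lawGood_all_of_interior_of_boundary hint (fun π i hi => lawGood_succ_of_boundary π i hi A fun ε π' => hsec i ε π') π

end Summit.CriticalPhenomena.PercolationContinuityZ3.Theorems.SahiThreeCopy
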